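/-
Copyright (c) 2026 the pub-hodgecm-mathlib formalisation cell (harness21).  Prover seat hodgecm-mathlib-K2E1-p14 (g4), Track B ∕ K2-LIT, h413 = `stmt-HodgeConjecture-24833`,
R90-TF section S8 «ContSpec-n½», socket (E) `sock_S8_res_exhaustion_le_closure` (B ED. 7 :276) — THE (N₃) LETTER OF RECORD: the visible binder `hNblk` of ★ p863683
`res_exhaustion_le_closure_of_letters` («an irreducible of `L²_res` has no mass in `Sc ⊓ (span eTop ⊔ span eMid)ᗮ`») PAID from ★ (N_blk,₃) `resG_isotypic_le_orthogonal_lines` at the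
ONE-SLOT block model `(0, U_Λ ∘ P_{Sc})`, modulo ★ (N_blk,₃)'s own E1 letters and ONE residue letter (C) (S8 dealer R90-CS-plan (g3) S8-R168 (1); census
`K2/K2E1-p14/g4/CENSUS-N3-LinesOfRecord.K2E1-p14-g4.md`).
-/
import Summits.HodgeConjecture.HodgeConjecture.Theorems.R90S8ResExhaustionLeClosureOfLettersU3     -- ★ p863683 (this seat): `hNblk_of_lineModel` (the (N₃) junction), `orthogonal_inf_orthogonal_mono`; brings ★ G-DEFS `resGBlock ∕ resGAtom ∕ resGLine`
import Summits.HodgeConjecture.HodgeConjecture.Theorems.R90S8ResGIsotypicVectorsAreResiduesU3      -- ★ (N_blk,₃) (R90-C133-p02 lineage): `resG_isotypic_le_orthogonal_lines` (:155) — D5′ at Mok's `U(J₃)`, any `(K′, ω)`, any three-slot model `U′`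
import HarnessLib

/-!
# S8 (E) road — `R90S8ResGIsotypicLeLinesOfRecordU3`: THE (N₃) LETTER OF RECORD `hNblk` of ★ p863683, PAID from ★ (N_blk,₃) at the one-slot block model `(0, U_Λ ∘ P_{Sc})`, modulo the E1
# Plancherel estate's letters (D5′ data, block projector, (L1) arch Hecke operators, (L2) multipliers on the Plancherel coordinate `U_Λ`, (L3) null level sets, `hScP`) and (C)

Track B ∕ K2-LIT, crux h413 = `stmt-HodgeConjecture-24833`, route of record `HCCMUnconditional`; cell `hodgecm-mathlib`, R90-TF programme, section S8 «ContSpec-n½», socket (E)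
`sock_S8_res_exhaustion_le_closure` (B ED. 7 :276–:292) via ★ p863683 `res_exhaustion_le_closure_of_letters` (= (E) modulo (HEAD₃)(O₃)(N₃)(L₃)).  THEOREMS ONLY (no `def`, no `instance`,
no `notation`, no named-fact hypothesis, no `sorry`; default heartbeats); lane `--supports stmt-HodgeConjecture-24833 --as helper` (count-neutral).  CLOSES NO SOCKET: it turns the (N₃)
letter of ★ p863683 into the E1 Plancherel estate's honest bill at `N = 3` (identical in shape to the H side ★ p862453) plus ONE residue letter (C).

THE MATHEMATICS ([MoeglinWaldspurger1995, IV.3.12 (b), V.3.13, VI.2]; [Rogawski1990, §13.9 p. 229]; [ReedSimonI1980, Thm. II.3]).  Fix a level datum `(K′, ω)` and a Borel datum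
`(χ₁, χ₂)` of `U_{L∕L⁺}(3)`, the block `Sc = resGBlock L μ K′ ω χ₁ χ₂` (closed ★ `isClosed_resGBlock`, hence complete: `P_{Sc} = Sc.orthogonalProjectionOnto` exists) and its PLANCHEREL
COORDINATE `U_Λ : Sc →ₗ L²(Ω, m; E)` (the E1 estate's spectral transform of the block onto the unitary axis).  ★ (N_blk,₃) `resG_isotypic_le_orthogonal_lines` (D5′ at Mok's `U(J₃)`: on
`V_P = Fix(P)` the arch Hecke operators `T_j` act through the LINE coordinate of a block model `U′` by multipliers `s_j` whose joint level sets are `m`-null; on an irreducible `W` they act by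
scalars; so `W ⟂ resGLine U′ = Sc ⊓ (resGAtom U′)ᗮ`) is stated for ANY three-slot model `U′ : L² →ₗ (A × M) × L²(Ω; E)`.  TAKE THE ONE-SLOT MODEL `U′ := (0, U_Λ ∘ P_{Sc})` (`A = M = ℂ`,
zero atom coordinates): its two model letters hold BY CONSTRUCTION — `hUker : Scᗮ ≤ ker U′` (`P_{Sc}` kills `Scᗮ`) and the line coordinate `(U′ y).2 = U_Λ (P_{Sc} y)` (`rfl`), so
★ (N_blk,₃)'s multiplier letter `hU` READS `U_Λ (P_{Sc} (T_j v)) = s_j • U_Λ (P_{Sc} v)` on `V_P` (the visible (L2) letter `hUΛ` below) — and its atoms are `resGAtom U′ = Sc ⊓ ker (U_Λ ∘ P_{Sc})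
= {v ∈ Sc | U_Λ v = 0}`, which lie in a residue space `A` exactly when **(C) `U_Λ v = 0 → v ∈ A`** (COMPLETENESS: a block vector without continuous spectrum is a combination of the
listed residues [MW VI.2] — the E1 estate's one genuinely spectral letter here).  Then `W ⊓ Fix ≤ (resGLine U′)ᗮ ≤ (Sc ⊓ Aᗮ)ᗮ` (★ p863683 §0 `orthogonal_inf_orthogonal_mono`), and at the
index of record `(K′, ω) = (ι_f Kf, 1)`, `A = span eTop ⊔ span eMid`, ★ p863683 §2 `hNblk_of_lineModel` converts `Fix_{ι_f(Kf)}(1)` to `Fix(ι_f Kf)`: the BYTES of `hNblk Kf b`.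
* §1 GENERIC (any complex inner-product space, any `Sc` with an orthogonal projection): the one-slot model `(0 : H →ₗ ℂ × ℂ).prod (U_Λ ∘ₗ P_{Sc})` — `oneSlot_snd_apply` (`rfl`),
  `oneSlot_orthogonal_le_ker` (`hUker`), `oneSlot_mem_of_snd_eq_zero` ((C) ⟹ the atoms lie in `A`).
* §2 **`resG_isotypic_le_orthogonal_residueSpan_of_lineModel`** — any `(K′, ω)`, any residue space `A`: `W ⊓ Fix_{K′}(ω) ≤ (Sc ⊓ Aᗮ)ᗮ` for every irreducible residual `W`, modulo ★ (N_blk,₃)'s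
  letters VERBATIM with (L2) `U′ s hs hU hUker` ↦ `U_Λ s hs hUΛ` (`hUker` DISCHARGED) + (C) `hC`.
* §3 **`hNblk_of_record`** — THE (N₃) LETTER OF RECORD: §2's data at `(K′, ω) := (ι_f Kf, 1)`, `A := span (range eTop) ⊔ span (range eMid)` ⊢ the `hNblk Kf b` bytes of ★ p863683 (one
  `exact` of ★ `hNblk_of_lineModel` over ★ `resG_isotypic_le_orthogonal_lines`).  CONSUMER: `hNblk := fun Kf b => hNblk_of_record L μ νinf νf κ hκ μK χ e m 𝔓 Kf.1 (χ₁ b) (χ₂ b) …`.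
VISIBLE BILL (the E1 Plancherel estate's, per block): D5′ data `νinf νf κ hκ μK χ e m` with `hχmul hχone hχinv`, the level idempotent `K′f he0 he1 heK hestar`, the block projector `P hPdef`,
(L1) `T hT𝓐 hTP hTB`, (L2) `U_Λ s hs hUΛ`, (L3) `hline`, `hScP : Sc ≤ V_P`, and (C) `hC`.  Nothing else; no statement of ★ p863683 or ★ (N_blk,₃) is restated.
HONEST LABEL: HC_CM is proved only modulo the 7 printed citations (2 remaining named inputs: hLiu418 = `stmt-HodgeConjecture-24832`, h413 = `stmt-HodgeConjecture-24833`) until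
rung 0 closes; REL ≠ ★ ≠ BUILT; this file asserts no named fact, is conditional by construction on its visible binders, and closes no socket; count-neutral.

## References
* [MoeglinWaldspurger1995] C. Mœglin, J.-L. Waldspurger, *Spectral Decomposition and Eisenstein Series* (1995), I.2.18, IV.3.12, V.3.13, VI.2.
* [Rogawski1990] J. D. Rogawski, *Automorphic Representations of Unitary Groups in Three Variables* (1990), §13.9 p. 229.
* [ReedSimonI1980] M. Reed, B. Simon, *Methods of Modern Mathematical Physics I* (1980), Thm. II.3, Thm. VII.2.
* [DeitmarEchterhoff2014] A. Deitmar, S. Echterhoff, *Principles of Harmonic Analysis* (2014), Lemma 6.1.7, Prop. 6.2.1.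
-/

set_option autoImplicit false
set_option linter.dupNamespace false  -- the mandated namespace `…HodgeConjecture.HodgeConjecture.R90.S8` (LEAD #1 L1) repeats the summit's segment

noncomputable section

open MeasureTheory Filter Topology CompactlySupported NumberField ContRepresentation Set
open scoped InnerProductSpace ENNReal ComplexConjugate
open Literature.NumberTheory.Automorphic Literature.NumberTheory.Automorphic.UnitaryGroup Literature.NumberTheory.GaloisRepresentations AdelicGroupData
open Literature.NumberTheory.Automorphic.Arthur2013.Leaves.TECR
open Summit.HodgeConjecture.HodgeConjecture.Cruxes.H413.K2E1CuspidalSpectrumUnitary (residualSubspace)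
open Summit.HodgeConjecture.HodgeConjecture.Cruxes.H413.K2E1HeckeAlgebraLettersCM

namespace Summit.HodgeConjecture.HodgeConjecture.R90.S8

/-! ## §1 Generic: the one-slot block model `(0, U_Λ ∘ P_{Sc})` and its read-backs -/

section OneSlot

variable {H : Type*} [NormedAddCommGroup H] [InnerProductSpace ℂ H] {Λ : Type*} [AddCommGroup Λ] [Module ℂ Λ]
  (Sc : Submodule ℂ H) [Sc.HasOrthogonalProjection] (UΛ : ↥Sc →ₗ[ℂ] Λ)

/-- **LINE COORDINATE OF THE ONE-SLOT MODEL**: `((0, U_Λ ∘ P_{Sc}) y).2 = U_Λ (P_{Sc} y)` — by `rfl`. [cite: ReedSimonI1980, Thm. II.3] -/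
theorem oneSlot_snd_apply (y : H) :
    (((0 : H →ₗ[ℂ] ℂ × ℂ).prod (UΛ ∘ₗ Sc.orthogonalProjectionOnto.toLinearMap)) y).2 = UΛ (Sc.orthogonalProjectionOnto y) :=
  rfl

/-- **`hUker` OF THE ONE-SLOT MODEL**: `Scᗮ ≤ ker (0, U_Λ ∘ P_{Sc})` — the orthogonal projection kills `Scᗮ` (★ `orthogonalProjectionOnto_apply_of_mem_orthogonal`). [cite: ReedSimonI1980, Thm. II.3] -/
theorem oneSlot_orthogonal_le_ker :
    Scᗮ ≤ LinearMap.ker ((0 : H →ₗ[ℂ] ℂ × ℂ).prod (UΛ ∘ₗ Sc.orthogonalProjectionOnto.toLinearMap)) := by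
  intro y hy
  rw [LinearMap.mem_ker, Prod.ext_iff]
  refine ⟨rfl, ?_⟩
  show UΛ (Sc.orthogonalProjectionOnto y) = 0
  rw [Submodule.orthogonalProjectionOnto_apply_of_mem_orthogonal hy, map_zero]

/-- **(C) ⟹ THE ATOMS OF THE ONE-SLOT MODEL LIE IN THE RESIDUE SPACE**: if `U_Λ v = 0 → v ∈ A` on `Sc` (COMPLETENESS), then every `v ∈ Sc` with zero line coordinate lies in `A`
(`P_{Sc} v = v` on `Sc`, ★ `orthogonalProjectionOnto_mem_subspace_eq_self`). [cite: MoeglinWaldspurger1995, VI.2] [cite: ReedSimonI1980, Thm. II.3] -/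
theorem oneSlot_mem_of_snd_eq_zero (A : Submodule ℂ H) (hC : ∀ v : ↥Sc, UΛ v = 0 → (v : H) ∈ A) {v : H} (hv : v ∈ Sc)
    (h0 : (((0 : H →ₗ[ℂ] ℂ × ℂ).prod (UΛ ∘ₗ Sc.orthogonalProjectionOnto.toLinearMap)) v).2 = 0) : v ∈ A := by
  have hP : Sc.orthogonalProjectionOnto v = ⟨v, hv⟩ := Submodule.orthogonalProjectionOnto_mem_subspace_eq_self (⟨v, hv⟩ : ↥Sc)
  rw [oneSlot_snd_apply, hP] at h0
  exact hC ⟨v, hv⟩ h0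

end OneSlot

/-! ## §2–§3 At Mok's `U(J₃) = quasiSplit L⁺ L c 3`: the (N₃) letter from ★ (N_blk,₃) at the one-slot model -/

section Record

variable (L : Type) [Field L] [NumberField L] [IsCMField L]
  (μ : Measure (quasiSplit (↥(maximalRealSubfield L)) L (IsCMField.complexConj L) 3).automorphicQuotient)
  [(quasiSplit (↥(maximalRealSubfield L)) L (IsCMField.complexConj L) 3).IsAutomorphicMeasure μ]
  {K : Type*} [Group K] [TopologicalSpace K] [MeasurableSpace K] [BorelSpace K]
  [MeasurableSpace (UnitaryGroup.arch (↥(maximalRealSubfield L)) L (IsCMField.complexConj L) 3 ((StdForm.antidiagonal 3).over L))] [BorelSpace (UnitaryGroup.arch (↥(maximalRealSubfield L)) L (IsCMField.complexConj L) 3 ((StdForm.antidiagonal 3).over L))]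
  [MeasurableSpace (finAdelic (↥(maximalRealSubfield L)) L (IsCMField.complexConj L) 3 ((StdForm.antidiagonal 3).over L))] [BorelSpace (finAdelic (↥(maximalRealSubfield L)) L (IsCMField.complexConj L) 3 ((StdForm.antidiagonal 3).over L))]
  (νinf : Measure (UnitaryGroup.arch (↥(maximalRealSubfield L)) L (IsCMField.complexConj L) 3 ((StdForm.antidiagonal 3).over L))) [IsFiniteMeasureOnCompacts νinf] [νinf.IsMulLeftInvariant] [νinf.IsInvInvariant] [νinf.IsOpenPosMeasure]
  (νf : Measure (finAdelic (↥(maximalRealSubfield L)) L (IsCMField.complexConj L) 3 ((StdForm.antidiagonal 3).over L))) [IsFiniteMeasureOnCompacts νf] [νf.IsMulLeftInvariant] [νf.IsInvInvariant] [νf.IsOpenPosMeasure]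
  (κ : K →* UnitaryGroup.arch (↥(maximalRealSubfield L)) L (IsCMField.complexConj L) 3 ((StdForm.antidiagonal 3).over L)) (hκ : Continuous κ)
  (μK : Measure K) [IsFiniteMeasureOnCompacts μK] [IsProbabilityMeasure μK] [MeasurableMul K] [μK.IsMulLeftInvariant] [MeasurableInv K] [μK.IsInvInvariant]
  (χ : C_c(K, ℂ)) (e : C_c(finAdelic (↥(maximalRealSubfield L)) L (IsCMField.complexConj L) 3 ((StdForm.antidiagonal 3).over L), ℂ))
  {Ω : Type*} {mΩ : MeasurableSpace Ω} (m : Measure Ω) {E : Type*} [NormedAddCommGroup E] [NormedSpace ℂ E] {J : Type*} [Countable J]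
variable [ENNReal.HolderTriple ∞ 2 2]

/-- **(N₃) AT ANY LEVEL DATUM AND ANY RESIDUE SPACE — «an irreducible of `L²_res(U(J₃), 𝔓)` has no `(K′, ω)`-isotypic mass in `Sc ⊓ Aᗮ`»**, modulo the E1 Plancherel estate's letters
(★ (N_blk,₃)'s VERBATIM: D5′ data `νinf νf κ hκ μK χ e m`, `hχmul hχone hχinv`, `K′f he0 he1 heK hestar`, `P hPdef`, (L1) `T hT𝓐 hTP hTB`, (L3) `hline`, `hScP`; (L2) in the
`U_Λ`-currency `UΛ s hs hUΛ` — Hecke multipliers on the Plancherel coordinate read through `P_{Sc}`) and the COMPLETENESS letter (C) `hC : U_Λ v = 0 → v ∈ A` on `Sc`.  PROOF: ★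
`resG_isotypic_le_orthogonal_lines` at the one-slot model `U′ := (0, U_Λ ∘ P_{Sc})` (`hU` = `hUΛ` by `rfl`, `hUker` §1), then `(resGLine U′)ᗮ ≤ (Sc ⊓ Aᗮ)ᗮ` (★ `orthogonal_inf_orthogonal_mono`,
`resGAtom U′ ≤ A` §1 from (C)). [cite: MoeglinWaldspurger1995, IV.3.12, V.3.13, VI.2] [cite: Rogawski1990, §13.9 p. 229] [cite: ReedSimonI1980, Thm. II.3] -/
theorem resG_isotypic_le_orthogonal_residueSpan_of_lineModel
    (𝔓 : (quasiSplit (↥(maximalRealSubfield L)) L (IsCMField.complexConj L) 3).ParabolicUnipotentData)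
    (K' : Subgroup (quasiSplit (↥(maximalRealSubfield L)) L (IsCMField.complexConj L) 3).Adelic) (ω : ↥K' →* ℂ)
    (χ₁ : HeckeCharacter L) (χ₂ : ↥(TorusDict.torus (IsCMField.complexConj L)) →ₜ* ℂˣ)
    (hχmul : ∀ k l, χ (k * l) = χ k * χ l) (hχone : χ 1 = 1) (hχinv : ∀ k, conj (χ k⁻¹) = χ k)
    (K'f : Subgroup (finAdelic (↥(maximalRealSubfield L)) L (IsCMField.complexConj L) 3 ((StdForm.antidiagonal 3).over L))) (he0 : ∀ x, x ∉ K'f → e x = 0) (he1 : ∫ x, e x ∂νf = 1)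
    (heK : ∀ k ∈ K'f, ∀ x, e (k * x) = e x) (hestar : ∀ x, mulStar (⇑e) x = e x)
    (P : (quasiSplit (↥(maximalRealSubfield L)) L (IsCMField.complexConj L) 3).L2 μ →L[ℂ] (quasiSplit (↥(maximalRealSubfield L)) L (IsCMField.complexConj L) 3).L2 μ)
    (hPdef : P = ((((quasiSplit (↥(maximalRealSubfield L)) L (IsCMField.complexConj L) 3).rightRegular μ).restrict ((archToAdelic (↥(maximalRealSubfield L)) L (IsCMField.complexConj L) 3 ((StdForm.antidiagonal 3).over L)).comp κ)).integratedOperator (((quasiSplit (↥(maximalRealSubfield L)) L (IsCMField.complexConj L) 3).isUnitary_rightRegular μ).restrict _)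
          (((quasiSplit (↥(maximalRealSubfield L)) L (IsCMField.complexConj L) 3).isStronglyContinuous_rightRegular_holds μ).restrict _ ((continuous_archToAdelic (↥(maximalRealSubfield L)) L (IsCMField.complexConj L) 3 ((StdForm.antidiagonal 3).over L)).comp hκ)) μK χ ∘L
        (((quasiSplit (↥(maximalRealSubfield L)) L (IsCMField.complexConj L) 3).rightRegular μ).restrict (finAdelicToAdelic (↥(maximalRealSubfield L)) L (IsCMField.complexConj L) 3 ((StdForm.antidiagonal 3).over L))).integratedOperator (((quasiSplit (↥(maximalRealSubfield L)) L (IsCMField.complexConj L) 3).isUnitary_rightRegular μ).restrict _) (((quasiSplit (↥(maximalRealSubfield L)) L (IsCMField.complexConj L) 3).isStronglyContinuous_rightRegular_holds μ).restrict _ (continuous_finAdelicToAdelic (↥(maximalRealSubfield L)) L (IsCMField.complexConj L) 3 ((StdForm.antidiagonal 3).over L))) νf e))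
    (T : J → (quasiSplit (↥(maximalRealSubfield L)) L (IsCMField.complexConj L) 3).L2 μ →L[ℂ] (quasiSplit (↥(maximalRealSubfield L)) L (IsCMField.complexConj L) 3).L2 μ)
    (hT𝓐 : ∀ j, T j ∈ {A' : (quasiSplit (↥(maximalRealSubfield L)) L (IsCMField.complexConj L) 3).L2 μ →L[ℂ] (quasiSplit (↥(maximalRealSubfield L)) L (IsCMField.complexConj L) 3).L2 μ | ∃ (a : C_c(UnitaryGroup.arch (↥(maximalRealSubfield L)) L (IsCMField.complexConj L) 3 ((StdForm.antidiagonal 3).over L), ℂ)) (b : C_c(finAdelic (↥(maximalRealSubfield L)) L (IsCMField.complexConj L) 3 ((StdForm.antidiagonal 3).over L), ℂ)),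
      A' = (((quasiSplit (↥(maximalRealSubfield L)) L (IsCMField.complexConj L) 3).rightRegular μ).restrict (archToAdelic (↥(maximalRealSubfield L)) L (IsCMField.complexConj L) 3 ((StdForm.antidiagonal 3).over L))).integratedOperator (((quasiSplit (↥(maximalRealSubfield L)) L (IsCMField.complexConj L) 3).isUnitary_rightRegular μ).restrict _) (((quasiSplit (↥(maximalRealSubfield L)) L (IsCMField.complexConj L) 3).isStronglyContinuous_rightRegular_holds μ).restrict _ (continuous_archToAdelic (↥(maximalRealSubfield L)) L (IsCMField.complexConj L) 3 ((StdForm.antidiagonal 3).over L))) νinf a ∘L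
          (((quasiSplit (↥(maximalRealSubfield L)) L (IsCMField.complexConj L) 3).rightRegular μ).restrict (finAdelicToAdelic (↥(maximalRealSubfield L)) L (IsCMField.complexConj L) 3 ((StdForm.antidiagonal 3).over L))).integratedOperator (((quasiSplit (↥(maximalRealSubfield L)) L (IsCMField.complexConj L) 3).isUnitary_rightRegular μ).restrict _) (((quasiSplit (↥(maximalRealSubfield L)) L (IsCMField.complexConj L) 3).isStronglyContinuous_rightRegular_holds μ).restrict _ (continuous_finAdelicToAdelic (↥(maximalRealSubfield L)) L (IsCMField.complexConj L) 3 ((StdForm.antidiagonal 3).over L))) νf b})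
    (hTP : ∀ j, Commute P (T j))
    (hTB : ∀ j, ∀ A' ∈ {A' : (quasiSplit (↥(maximalRealSubfield L)) L (IsCMField.complexConj L) 3).L2 μ →L[ℂ] (quasiSplit (↥(maximalRealSubfield L)) L (IsCMField.complexConj L) 3).L2 μ | ∃ (a : C_c(UnitaryGroup.arch (↥(maximalRealSubfield L)) L (IsCMField.complexConj L) 3 ((StdForm.antidiagonal 3).over L), ℂ)) (b : C_c(finAdelic (↥(maximalRealSubfield L)) L (IsCMField.complexConj L) 3 ((StdForm.antidiagonal 3).over L), ℂ)),
      A' = (((quasiSplit (↥(maximalRealSubfield L)) L (IsCMField.complexConj L) 3).rightRegular μ).restrict (archToAdelic (↥(maximalRealSubfield L)) L (IsCMField.complexConj L) 3 ((StdForm.antidiagonal 3).over L))).integratedOperator (((quasiSplit (↥(maximalRealSubfield L)) L (IsCMField.complexConj L) 3).isUnitary_rightRegular μ).restrict _) (((quasiSplit (↥(maximalRealSubfield L)) L (IsCMField.complexConj L) 3).isStronglyContinuous_rightRegular_holds μ).restrict _ (continuous_archToAdelic (↥(maximalRealSubfield L)) L (IsCMField.complexConj L) 3 ((StdForm.antidiagonal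 3).over L))) νinf a ∘L
          (((quasiSplit (↥(maximalRealSubfield L)) L (IsCMField.complexConj L) 3).rightRegular μ).restrict (finAdelicToAdelic (↥(maximalRealSubfield L)) L (IsCMField.complexConj L) 3 ((StdForm.antidiagonal 3).over L))).integratedOperator (((quasiSplit (↥(maximalRealSubfield L)) L (IsCMField.complexConj L) 3).isUnitary_rightRegular μ).restrict _) (((quasiSplit (↥(maximalRealSubfield L)) L (IsCMField.complexConj L) 3).isStronglyContinuous_rightRegular_holds μ).restrict _ (continuous_finAdelicToAdelic (↥(maximalRealSubfield L)) L (IsCMField.complexConj L) 3 ((StdForm.antidiagonal 3).over L))) νf b},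
      ∀ x ∈ LinearMap.eqLocus (P : (quasiSplit (↥(maximalRealSubfield L)) L (IsCMField.complexConj L) 3).L2 μ →ₗ[ℂ] (quasiSplit (↥(maximalRealSubfield L)) L (IsCMField.complexConj L) 3).L2 μ) LinearMap.id, P (A' (T j x)) = T j (P (A' x)))
    (UΛ : ↥(resGBlock L μ K' ω χ₁ χ₂) →ₗ[ℂ] Lp E 2 m) (s : J → Ω → ℂ) (hs : ∀ j, MemLp (s j) ∞ m)
    (hUΛ : haveI : CompleteSpace ↥(resGBlock L μ K' ω χ₁ χ₂) := (isClosed_resGBlock L μ _ _ χ₁ χ₂).completeSpace_coe;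
      ∀ j, ∀ v ∈ LinearMap.eqLocus (P : (quasiSplit (↥(maximalRealSubfield L)) L (IsCMField.complexConj L) 3).L2 μ →ₗ[ℂ] (quasiSplit (↥(maximalRealSubfield L)) L (IsCMField.complexConj L) 3).L2 μ) LinearMap.id,
        UΛ ((resGBlock L μ K' ω χ₁ χ₂).orthogonalProjectionOnto (T j v)) = ((hs j).toLp (s j) • UΛ ((resGBlock L μ K' ω χ₁ χ₂).orthogonalProjectionOnto v) : Lp E 2 m))
    (hline : ∀ c : J → ℂ, m {x | ∀ j, s j x = c j} = 0)
    (hScP : resGBlock L μ K' ω χ₁ χ₂ ≤ LinearMap.eqLocus (P : (quasiSplit (↥(maximalRealSubfield L)) L (IsCMField.complexConj L) 3).L2 μ →ₗ[ℂ] (quasiSplit (↥(maximalRealSubfield L)) L (IsCMField.complexConj L) 3).L2 μ) LinearMap.id)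
    (A : Submodule ℂ ((quasiSplit (↥(maximalRealSubfield L)) L (IsCMField.complexConj L) 3).L2 μ)) (hC : ∀ v : ↥(resGBlock L μ K' ω χ₁ χ₂), UΛ v = 0 → (v : (quasiSplit (↥(maximalRealSubfield L)) L (IsCMField.complexConj L) 3).L2 μ) ∈ A) :
    ∀ W' : ClosedSubrep ((quasiSplit (↥(maximalRealSubfield L)) L (IsCMField.complexConj L) 3).rightRegular μ), W'.toContRep.IsTopIrreducible →
      W' ≤ residualSubspace (quasiSplit (↥(maximalRealSubfield L)) L (IsCMField.complexConj L) 3) μ 𝔓 →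
        W'.toSubmodule ⊓ (⨅ k : ↥K', Module.End.eigenspace ((((quasiSplit (↥(maximalRealSubfield L)) L (IsCMField.complexConj L) 3).rightRegular μ) (K'.subtype k) : (quasiSplit (↥(maximalRealSubfield L)) L (IsCMField.complexConj L) 3).L2 μ →L[ℂ] (quasiSplit (↥(maximalRealSubfield L)) L (IsCMField.complexConj L) 3).L2 μ) :
          (quasiSplit (↥(maximalRealSubfield L)) L (IsCMField.complexConj L) 3).L2 μ →ₗ[ℂ] (quasiSplit (↥(maximalRealSubfield L)) L (IsCMField.complexConj L) 3).L2 μ) (ω k)) ≤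
          (resGBlock L μ K' ω χ₁ χ₂ ⊓ Aᗮ)ᗮ := by
  haveI : CompleteSpace ↥(resGBlock L μ K' ω χ₁ χ₂) := (isClosed_resGBlock L μ K' ω χ₁ χ₂).completeSpace_coe
  intro W' hW' hres
  exact (resG_isotypic_le_orthogonal_lines L μ νinf νf κ hκ μK χ e m 𝔓 K' ω χ₁ χ₂ hχmul hχone hχinv K'f he0 he1 heK hestar P hPdef T hT𝓐 hTP hTB
      ((0 : (quasiSplit (↥(maximalRealSubfield L)) L (IsCMField.complexConj L) 3).L2 μ →ₗ[ℂ] ℂ × ℂ).prod (UΛ ∘ₗ (resGBlock L μ K' ω χ₁ χ₂).orthogonalProjectionOnto.toLinearMap)) s hs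
      (fun j v hv => hUΛ j v hv) hline hScP (oneSlot_orthogonal_le_ker _ UΛ) W' hW' hres).trans
    (orthogonal_inf_orthogonal_mono _ _ _ fun v hv =>
      oneSlot_mem_of_snd_eq_zero _ UΛ A hC ((mem_resGAtom_iff L μ _ K' ω χ₁ χ₂ v).1 hv).1 ((mem_resGAtom_iff L μ _ K' ω χ₁ χ₂ v).1 hv).2)

/-- **THE (N₃) LETTER OF RECORD `hNblk` (bytes of ★ p863683 `res_exhaustion_le_closure_of_letters`, per `(Kf, b)`) PAID**: at the index of record `(K′, ω) := (ι_f Kf, 1)` and the residue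
space `A := span (range eTop) ⊔ span (range eMid)` of the block's listed top- and middle-pole residue classes, §2's letters give
`W ⊓ Fix(ι_f Kf) ≤ (Sc ⊓ (span eTop ⊔ span eMid)ᗮ)ᗮ` for every irreducible residual `W` — one `exact` of ★ `hNblk_of_lineModel` (p863683 §2: `Fix(ι_f Kf) ≤ Fix_{ι_f(Kf)}(1)`,
atoms `≤ A`) over ★ `resG_isotypic_le_orthogonal_lines` at the one-slot model.  CONSUMER (the future (E) payment line): `hNblk := fun Kf b => hNblk_of_record … Kf.1 (χ₁ b) (χ₂ b) …`.
So (N₃) = ★ MODULO {D5′ data + `P hPdef` + (L1) + (L2) `U_Λ s hs hUΛ` + (L3) `hline` + `hScP` + (C)} at each block of record. [cite: MoeglinWaldspurger1995, IV.3.12, V.3.13, VI.2] [cite: Rogawski1990, §13.9 p. 229] -/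
theorem hNblk_of_record
    (𝔓 : (quasiSplit (↥(maximalRealSubfield L)) L (IsCMField.complexConj L) 3).ParabolicUnipotentData)
    (Kf : Subgroup ↥(finAdelic (↥(maximalRealSubfield L)) L (IsCMField.complexConj L) 3 ((StdForm.antidiagonal 3).over L)))
    (χ₁ : HeckeCharacter L) (χ₂ : ↥(TorusDict.torus (IsCMField.complexConj L)) →ₜ* ℂˣ)
    (hχmul : ∀ k l, χ (k * l) = χ k * χ l) (hχone : χ 1 = 1) (hχinv : ∀ k, conj (χ k⁻¹) = χ k)
    (K'f : Subgroup (finAdelic (↥(maximalRealSubfield L)) L (IsCMField.complexConj L) 3 ((StdForm.antidiagonal 3).over L))) (he0 : ∀ x, x ∉ K'f → e x = 0) (he1 : ∫ x, e x ∂νf = 1)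
    (heK : ∀ k ∈ K'f, ∀ x, e (k * x) = e x) (hestar : ∀ x, mulStar (⇑e) x = e x)
    (P : (quasiSplit (↥(maximalRealSubfield L)) L (IsCMField.complexConj L) 3).L2 μ →L[ℂ] (quasiSplit (↥(maximalRealSubfield L)) L (IsCMField.complexConj L) 3).L2 μ)
    (hPdef : P = ((((quasiSplit (↥(maximalRealSubfield L)) L (IsCMField.complexConj L) 3).rightRegular μ).restrict ((archToAdelic (↥(maximalRealSubfield L)) L (IsCMField.complexConj L) 3 ((StdForm.antidiagonal 3).over L)).comp κ)).integratedOperator (((quasiSplit (↥(maximalRealSubfield L)) L (IsCMField.complexConj L) 3).isUnitary_rightRegular μ).restrict _)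
          (((quasiSplit (↥(maximalRealSubfield L)) L (IsCMField.complexConj L) 3).isStronglyContinuous_rightRegular_holds μ).restrict _ ((continuous_archToAdelic (↥(maximalRealSubfield L)) L (IsCMField.complexConj L) 3 ((StdForm.antidiagonal 3).over L)).comp hκ)) μK χ ∘L
        (((quasiSplit (↥(maximalRealSubfield L)) L (IsCMField.complexConj L) 3).rightRegular μ).restrict (finAdelicToAdelic (↥(maximalRealSubfield L)) L (IsCMField.complexConj L) 3 ((StdForm.antidiagonal 3).over L))).integratedOperator (((quasiSplit (↥(maximalRealSubfield L)) L (IsCMField.complexConj L) 3).isUnitary_rightRegular μ).restrict _) (((quasiSplit (↥(maximalRealSubfield L)) L (IsCMField.complexConj L) 3).isStronglyContinuous_rightRegular_holds μ).restrict _ (continuous_finAdelicToAdelic (↥(maximalRealSubfield L)) L (IsCMField.complexConj L) 3 ((StdForm.antidiagonal 3).over L))) νf e))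
    (T : J → (quasiSplit (↥(maximalRealSubfield L)) L (IsCMField.complexConj L) 3).L2 μ →L[ℂ] (quasiSplit (↥(maximalRealSubfield L)) L (IsCMField.complexConj L) 3).L2 μ)
    (hT𝓐 : ∀ j, T j ∈ {A' : (quasiSplit (↥(maximalRealSubfield L)) L (IsCMField.complexConj L) 3).L2 μ →L[ℂ] (quasiSplit (↥(maximalRealSubfield L)) L (IsCMField.complexConj L) 3).L2 μ | ∃ (a : C_c(UnitaryGroup.arch (↥(maximalRealSubfield L)) L (IsCMField.complexConj L) 3 ((StdForm.antidiagonal 3).over L), ℂ)) (b : C_c(finAdelic (↥(maximalRealSubfield L)) L (IsCMField.complexConj L) 3 ((StdForm.antidiagonal 3).over L), ℂ)),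
      A' = (((quasiSplit (↥(maximalRealSubfield L)) L (IsCMField.complexConj L) 3).rightRegular μ).restrict (archToAdelic (↥(maximalRealSubfield L)) L (IsCMField.complexConj L) 3 ((StdForm.antidiagonal 3).over L))).integratedOperator (((quasiSplit (↥(maximalRealSubfield L)) L (IsCMField.complexConj L) 3).isUnitary_rightRegular μ).restrict _) (((quasiSplit (↥(maximalRealSubfield L)) L (IsCMField.complexConj L) 3).isStronglyContinuous_rightRegular_holds μ).restrict _ (continuous_archToAdelic (↥(maximalRealSubfield L)) L (IsCMField.complexConj L) 3 ((StdForm.antidiagonal 3).over L))) νinf a ∘L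
          (((quasiSplit (↥(maximalRealSubfield L)) L (IsCMField.complexConj L) 3).rightRegular μ).restrict (finAdelicToAdelic (↥(maximalRealSubfield L)) L (IsCMField.complexConj L) 3 ((StdForm.antidiagonal 3).over L))).integratedOperator (((quasiSplit (↥(maximalRealSubfield L)) L (IsCMField.complexConj L) 3).isUnitary_rightRegular μ).restrict _) (((quasiSplit (↥(maximalRealSubfield L)) L (IsCMField.complexConj L) 3).isStronglyContinuous_rightRegular_holds μ).restrict _ (continuous_finAdelicToAdelic (↥(maximalRealSubfield L)) L (IsCMField.complexConj L) 3 ((StdForm.antidiagonal 3).over L))) νf b})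
    (hTP : ∀ j, Commute P (T j))
    (hTB : ∀ j, ∀ A' ∈ {A' : (quasiSplit (↥(maximalRealSubfield L)) L (IsCMField.complexConj L) 3).L2 μ →L[ℂ] (quasiSplit (↥(maximalRealSubfield L)) L (IsCMField.complexConj L) 3).L2 μ | ∃ (a : C_c(UnitaryGroup.arch (↥(maximalRealSubfield L)) L (IsCMField.complexConj L) 3 ((StdForm.antidiagonal 3).over L), ℂ)) (b : C_c(finAdelic (↥(maximalRealSubfield L)) L (IsCMField.complexConj L) 3 ((StdForm.antidiagonal 3).over L), ℂ)),
      A' = (((quasiSplit (↥(maximalRealSubfield L)) L (IsCMField.complexConj L) 3).rightRegular μ).restrict (archToAdelic (↥(maximalRealSubfield L)) L (IsCMField.complexConj L) 3 ((StdForm.antidiagonal 3).over L))).integratedOperator (((quasiSplit (↥(maximalRealSubfield L)) L (IsCMField.complexConj L) 3).isUnitary_rightRegular μ).restrict _) (((quasiSplit (↥(maximalRealSubfield L)) L (IsCMField.complexConj L) 3).isStronglyContinuous_rightRegular_holds μ).restrict _ (continuous_archToAdelic (↥(maximalRealSubfield L)) L (IsCMField.complexConj L) 3 ((StdForm.antidiagonal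 3).over L))) νinf a ∘L
          (((quasiSplit (↥(maximalRealSubfield L)) L (IsCMField.complexConj L) 3).rightRegular μ).restrict (finAdelicToAdelic (↥(maximalRealSubfield L)) L (IsCMField.complexConj L) 3 ((StdForm.antidiagonal 3).over L))).integratedOperator (((quasiSplit (↥(maximalRealSubfield L)) L (IsCMField.complexConj L) 3).isUnitary_rightRegular μ).restrict _) (((quasiSplit (↥(maximalRealSubfield L)) L (IsCMField.complexConj L) 3).isStronglyContinuous_rightRegular_holds μ).restrict _ (continuous_finAdelicToAdelic (↥(maximalRealSubfield L)) L (IsCMField.complexConj L) 3 ((StdForm.antidiagonal 3).over L))) νf b},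
      ∀ x ∈ LinearMap.eqLocus (P : (quasiSplit (↥(maximalRealSubfield L)) L (IsCMField.complexConj L) 3).L2 μ →ₗ[ℂ] (quasiSplit (↥(maximalRealSubfield L)) L (IsCMField.complexConj L) 3).L2 μ) LinearMap.id, P (A' (T j x)) = T j (P (A' x)))
    (UΛ : ↥(resGBlock L μ (Kf.map (finAdelicToAdelic (↥(maximalRealSubfield L)) L (IsCMField.complexConj L) 3 ((StdForm.antidiagonal 3).over L))) 1 χ₁ χ₂) →ₗ[ℂ] Lp E 2 m) (s : J → Ω → ℂ) (hs : ∀ j, MemLp (s j) ∞ m)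
    (hUΛ : haveI : CompleteSpace ↥(resGBlock L μ (Kf.map (finAdelicToAdelic (↥(maximalRealSubfield L)) L (IsCMField.complexConj L) 3 ((StdForm.antidiagonal 3).over L))) 1 χ₁ χ₂) := (isClosed_resGBlock L μ _ _ χ₁ χ₂).completeSpace_coe;
      ∀ j, ∀ v ∈ LinearMap.eqLocus (P : (quasiSplit (↥(maximalRealSubfield L)) L (IsCMField.complexConj L) 3).L2 μ →ₗ[ℂ] (quasiSplit (↥(maximalRealSubfield L)) L (IsCMField.complexConj L) 3).L2 μ) LinearMap.id,
        UΛ ((resGBlock L μ (Kf.map (finAdelicToAdelic (↥(maximalRealSubfield L)) L (IsCMField.complexConj L) 3 ((StdForm.antidiagonal 3).over L))) 1 χ₁ χ₂).orthogonalProjectionOnto (T j v)) = ((hs j).toLp (s j) • UΛ ((resGBlock L μ (Kf.map (finAdelicToAdelic (↥(maximalRealSubfield L)) L (IsCMField.complexConj L) 3 ((StdForm.antidiagonal 3).over L))) 1 χ₁ χ₂).orthogonalProjectionOnto v) : Lp E 2 m))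
    (hline : ∀ c : J → ℂ, m {x | ∀ j, s j x = c j} = 0)
    (hScP : resGBlock L μ (Kf.map (finAdelicToAdelic (↥(maximalRealSubfield L)) L (IsCMField.complexConj L) 3 ((StdForm.antidiagonal 3).over L))) 1 χ₁ χ₂ ≤ LinearMap.eqLocus (P : (quasiSplit (↥(maximalRealSubfield L)) L (IsCMField.complexConj L) 3).L2 μ →ₗ[ℂ] (quasiSplit (↥(maximalRealSubfield L)) L (IsCMField.complexConj L) 3).L2 μ) LinearMap.id)
    {ιt ιm : Type*} (eTop : ιt → (quasiSplit (↥(maximalRealSubfield L)) L (IsCMField.complexConj L) 3).L2 μ) (eMid : ιm → (quasiSplit (↥(maximalRealSubfield L)) L (IsCMField.complexConj L) 3).L2 μ)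
    (hC : ∀ v : ↥(resGBlock L μ (Kf.map (finAdelicToAdelic (↥(maximalRealSubfield L)) L (IsCMField.complexConj L) 3 ((StdForm.antidiagonal 3).over L))) 1 χ₁ χ₂), UΛ v = 0 → (v : (quasiSplit (↥(maximalRealSubfield L)) L (IsCMField.complexConj L) 3).L2 μ) ∈ Submodule.span ℂ (Set.range eTop) ⊔ Submodule.span ℂ (Set.range eMid)) :
    ∀ W : ClosedSubrep ((quasiSplit (↥(maximalRealSubfield L)) L (IsCMField.complexConj L) 3).rightRegular μ), W.toContRep.IsTopIrreducible → W ≤ residualSubspace (quasiSplit (↥(maximalRealSubfield L)) L (IsCMField.complexConj L) 3) μ 𝔓 →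
      W.toSubmodule ⊓ (⨅ u : ↥(Kf), Module.End.eigenspace ((((quasiSplit (↥(maximalRealSubfield L)) L (IsCMField.complexConj L) 3).rightRegular μ) (finAdelicToAdelic (↥(maximalRealSubfield L)) L (IsCMField.complexConj L) 3 ((StdForm.antidiagonal 3).over L) (u : ↥(finAdelic (↥(maximalRealSubfield L)) L (IsCMField.complexConj L) 3 ((StdForm.antidiagonal 3).over L)))) :
        (quasiSplit (↥(maximalRealSubfield L)) L (IsCMField.complexConj L) 3).L2 μ →L[ℂ] (quasiSplit (↥(maximalRealSubfield L)) L (IsCMField.complexConj L) 3).L2 μ) : (quasiSplit (↥(maximalRealSubfield L)) L (IsCMField.complexConj L) 3).L2 μ →ₗ[ℂ] (quasiSplit (↥(maximalRealSubfield L)) L (IsCMField.complexConj L) 3).L2 μ) 1) ≤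
        (resGBlock L μ (Kf.map (finAdelicToAdelic (↥(maximalRealSubfield L)) L (IsCMField.complexConj L) 3 ((StdForm.antidiagonal 3).over L))) 1 χ₁ χ₂ ⊓ (Submodule.span ℂ (Set.range eTop) ⊔ Submodule.span ℂ (Set.range eMid))ᗮ)ᗮ := by
  haveI : CompleteSpace ↥(resGBlock L μ (Kf.map (finAdelicToAdelic (↥(maximalRealSubfield L)) L (IsCMField.complexConj L) 3 ((StdForm.antidiagonal 3).over L))) 1 χ₁ χ₂) := (isClosed_resGBlock L μ _ 1 χ₁ χ₂).completeSpace_coe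
  exact hNblk_of_lineModel L μ 𝔓 Kf χ₁ χ₂ ((0 : (quasiSplit (↥(maximalRealSubfield L)) L (IsCMField.complexConj L) 3).L2 μ →ₗ[ℂ] ℂ × ℂ).prod (UΛ ∘ₗ (resGBlock L μ (Kf.map (finAdelicToAdelic (↥(maximalRealSubfield L)) L (IsCMField.complexConj L) 3 ((StdForm.antidiagonal 3).over L))) 1 χ₁ χ₂).orthogonalProjectionOnto.toLinearMap))
    (Submodule.span ℂ (Set.range eTop) ⊔ Submodule.span ℂ (Set.range eMid))
    (fun v hv => oneSlot_mem_of_snd_eq_zero _ UΛ _ hC ((mem_resGAtom_iff L μ _ _ 1 χ₁ χ₂ v).1 hv).1 ((mem_resGAtom_iff L μ _ _ 1 χ₁ χ₂ v).1 hv).2)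
    (resG_isotypic_le_orthogonal_lines L μ νinf νf κ hκ μK χ e m 𝔓 (Kf.map (finAdelicToAdelic (↥(maximalRealSubfield L)) L (IsCMField.complexConj L) 3 ((StdForm.antidiagonal 3).over L))) 1 χ₁ χ₂ hχmul hχone hχinv K'f he0 he1 heK hestar P hPdef T hT𝓐 hTP hTB
      ((0 : (quasiSplit (↥(maximalRealSubfield L)) L (IsCMField.complexConj L) 3).L2 μ →ₗ[ℂ] ℂ × ℂ).prod (UΛ ∘ₗ (resGBlock L μ (Kf.map (finAdelicToAdelic (↥(maximalRealSubfield L)) L (IsCMField.complexConj L) 3 ((StdForm.antidiagonal 3).over L))) 1 χ₁ χ₂).orthogonalProjectionOnto.toLinearMap)) s hs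
      (fun j v hv => hUΛ j v hv) hline hScP (oneSlot_orthogonal_le_ker _ UΛ))

end Record

end Summit.HodgeConjecture.HodgeConjecture.R90.S8

end
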